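import Literature.Topology.FourManifolds.ConcordanceStripTubeGeometry
import Literature.Topology.FourManifolds.KnotOfClosedCurve
import HarnessLib

/-!
# Replacing a strip of a conical concordance inside a good tube

Topic `Literature/Topology/FourManifolds`; sequel of `ConcordanceStripTubeGeometry.lean` in the
decomposition of the Fox–Milnor congruence
`Literature.Topology.FourManifolds.Knot.IsConnectedSum.isConcordant` (remaining named fact:
`Knot.exists_isConnectedSum_isConcordant_left`, `BandSumConcordanceCore.lean`). This file turns
the good tube of a conical concordance (`Knot.IsConicalConcordance.exists_goodTube`) into a
**machine producing new concordances**: any *detour* of the core curve in tube coordinates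
gives a new conical concordance between the correspondingly modified end knots. Everything is
proved:

* `StripFrame.descend G` — the descent to `𝕊¹ × ℝ` of a map `G : ℝ × ℝ → ℝ⁴` which is
  `1`-periodic in the angle (via the angle functions `angA`/`angB` of `TorusCoordinates.lean`,
  as `periodicLift` of `DehnSurgeryTubularNbhdProofs.lean` does for `ℝ × ℝ²`): smooth
  (`contMDiff_descend`) with injective differential where `DG` is injective at a lift
  (`mfderiv_descend_injective`).
* `StripFrame.InArc a b u` — `circlePt u` lies in the arc `circlePt '' [a, b]` (a closed
  condition on `u`, `isClosed_setOf_inArc`; equivalently some integer translate of `u` lies in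
  `[a, b]`, `inArc_iff`).
* `StripFrame.TubeSetup.tube_add_int` — the tube of a periodic setup is `1`-periodic in the
  angle (`Knot.IsConicalConcordance.tube_add_int` for the setup of a conical concordance).
* `StripFrame.Detour θ₀ η ε` — a `C^∞` curve `u ↦ (κθ u, κd u)` in tube coordinates,
  equivariant under the period, equal to the zero section off the arc
  `[θ₀ - η/8, θ₀ + η/8]`, over the core strip and inside the radius on it, injective modulo the
  period, regular (`velL`, `injective_velL`, `hasFDerivAt_coords`).
* `Knot.IsConicalConcordance.newLift h w D (u, t) = tube ((κθ u, t), κd u)` — the modified lift: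
  smooth, periodic, equal to the old lift off the arc (`newLift_of_not_inArc`), **conical near
  the ends for all `u`** (`newLift_of_le : newLift (u, t) = t • newLift (u, 1)` for
  `t ≤ 1 + δ/4`, `newLift_of_ge`; the cone tubes of `ConcordanceStripTube.lean`), and over the
  annulus `1 ≤ t ≤ 2`, given a good tube `G`: an immersion (`injective_fderiv_newLift`),
  identifying exactly the period translates (`eq_of_newLift_eq`: the four cases on/off the arc
  are settled by injectivity of the tube, `GoodTube.separated`, and injectivity of the old
  lift), with values in the open shell over the open annulus (`norm_newLift_mem`).
* `endCurve₁`, `endCurve₂` — the end curves `θ ↦ newLift (θ/2π, 1)`, `θ ↦ ½ • newLift (θ/2π, 2)`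
  are regular simple closed curves on `𝕊³` (`isRegularClosedCurve_endCurve₁/₂`,
  `endCurve₁/₂_inj`), hence knots `newKnot₁ D G`, `newKnot₂ D G`
  (`IsRegularClosedCurve.toKnot`, `KnotOfClosedCurve.lean`), equal to `K`, `K'` off the arc
  (`coe_newKnot_circlePt_of_not_inArc`).
* **`Knot.IsConicalConcordance.isConcordance_newAnnulus`** — the descent `newAnnulus` of the
  new lift is a concordance (`Knot.IsConcordance`) from `newKnot₁ D G` to `newKnot₂ D G`, indeed
  again a conical one of width `δ/4` (`isConicalConcordance_newAnnulus`).

The sequel chooses the detour: a band sum, inside the tube over `t = 1`, of the core arc of `K`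
with a small copy of the second factor; the same detour read at `t = 2` is a band sum of `K'`
with a copy of the second factor, and the theorem above is the concordance between the two
connected sums.

## References

* R. H. Fox, J. W. Milnor, *Singularities of 2-spheres in 4-space and cobordism of knots*, Osaka
  J. Math. 3 (1966), §1. [FoxMilnor1966]
* M. W. Hirsch, *Differential Topology*, GTM 33 (1976), Ch. 4 §5 (tubular neighbourhoods),
  Ch. 1 §3 (injective immersions of compact manifolds are embeddings). [HirschDT1976]

## Design notes

* All periodicity is period `1` on the parameter line (`circlePt`), converted to the
  `2π`-convention of `KnotOfClosedCurve.lean` only for the end curves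
  (`circlePoint_eq_circlePt_div`).
* `Detour` carries data (two functions) and is a `Type`-valued structure; the good tube `G` and
  the conical concordance `h` stay hypotheses of the statements. No named facts, no `sorry`.
  Notation `𝔼 n`, `𝕊 n`, `𝓘₁₁` is local (the first two byte-identical to `Knots.lean`).
-/

open scoped Manifold ContDiff Topology RealInnerProductSpace
open Function Set Metric

noncomputable section

namespace Literature.Topology.FourManifolds

/-- Local notation: `𝔼 n` is the model Euclidean space `EuclideanSpace ℝ (Fin n)`. -/
local notation "𝔼 " n:arg => EuclideanSpace ℝ (Fin n)

/-- Local notation: `𝕊 n` is the unit sphere in `EuclideanSpace ℝ (Fin (n + 1))`. -/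
local notation "𝕊 " n:arg => (Metric.sphere (0 : EuclideanSpace ℝ (Fin (n + 1))) 1)

/-- Local notation: the model with corners of `𝕊¹ × ℝ`. -/
local notation "𝓘₁₁" => (ModelWithCorners.prod (𝓡 1) 𝓘(ℝ, ℝ))

attribute [local instance] fact_finrank_euclideanSpace_two fact_finrank_euclideanSpace_four

namespace StripFrame

/-! ### Descending a `1`-periodic map `ℝ × ℝ → ℝ⁴` to `𝕊¹ × ℝ` -/

section Descend

variable {G : ℝ × ℝ → 𝔼 4}

/-- A map `1`-periodic in its first argument takes equal values at reals with the same point on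
the circle (`circlePt`, period `1`). [folklore] -/
theorem apply_eq_of_circlePt_eq (hper : ∀ θ t, G (θ + 1, t) = G (θ, t)) {s u : ℝ}
    (h : circlePt s = circlePt u) (t : ℝ) : G (s, t) = G (u, t) := by
  obtain ⟨m, rfl⟩ := circlePt_eq_circlePt_iff.1 h
  have hp : Periodic (fun θ ↦ G (θ, t)) 1 := fun θ ↦ hper θ t
  have := (hp.int_mul m) u
  simpa using this

variable (G) in
/-- **The descent** to `𝕊¹ × ℝ` of a map `G : ℝ × ℝ → ℝ⁴` which is `1`-periodic in the first
variable: `(x, t) ↦ G (u, t)` for any `u` with `circlePt u = x` (implemented with the angle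
function `angA` of `TorusCoordinates.lean`; independent of the choice, `descend_circlePt`).
[folklore] -/
def descend (p : (𝕊 1) × ℝ) : 𝔼 4 :=
  G (angA p.1, p.2)

/-- The descent over an angle: `descend G (circlePt u, t) = G (u, t)`. [folklore] -/
theorem descend_circlePt (hper : ∀ θ t, G (θ + 1, t) = G (θ, t)) (u t : ℝ) :
    descend G (circlePt u, t) = G (u, t) :=
  apply_eq_of_circlePt_eq hper (circlePt_angA _) t

/-- The descent computed with the other angle function `angB`. [folklore] -/
theorem descend_eq_angB (hper : ∀ θ t, G (θ + 1, t) = G (θ, t)) (p : (𝕊 1) × ℝ) :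
    descend G p = G (angB p.1, p.2) :=
  apply_eq_of_circlePt_eq hper (by rw [circlePt_angA, circlePt_angB]) p.2

/-- The angle chart `(x, t) ↦ (ang x, t)` is smooth where `ang` is. [folklore] -/
theorem contMDiffAt_angleProd {ang : (𝕊 1) → ℝ} {p : (𝕊 1) × ℝ}
    (hang : ContMDiffAt (𝓡 1) 𝓘(ℝ, ℝ) ∞ ang p.1) :
    ContMDiffAt 𝓘₁₁ 𝓘(ℝ, ℝ × ℝ) ∞ (fun q : (𝕊 1) × ℝ ↦ (ang q.1, q.2)) p :=
  (hang.comp p contMDiffAt_fst).prodMk_space contMDiffAt_snd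

/-- **The descent of a `C^∞` periodic map is `C^∞`** on `𝕊¹ × ℝ`. [folklore] -/
theorem contMDiff_descend (hG : ContDiff ℝ ∞ G) (hper : ∀ θ t, G (θ + 1, t) = G (θ, t)) :
    ContMDiff 𝓘₁₁ 𝓘(ℝ, 𝔼 4) ∞ (descend G) := by
  intro p
  by_cases hp : p.1 = ptA
  · have hfun : descend G = G ∘ fun q : (𝕊 1) × ℝ ↦ (angB q.1, q.2) :=
      funext fun q ↦ descend_eq_angB hper q
    rw [hfun]
    have hB : p.1 ≠ ptB := by rw [hp]; exact ptA_ne_ptB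
    exact hG.contDiffAt.comp_contMDiffAt (contMDiffAt_angleProd (contMDiffAt_angB hB))
  · have hfun : descend G = G ∘ fun q : (𝕊 1) × ℝ ↦ (angA q.1, q.2) := rfl
    rw [hfun]
    exact hG.contDiffAt.comp_contMDiffAt (contMDiffAt_angleProd (contMDiffAt_angA hp))

/-- **Injectivity of the differential of the descent** at `p = (x, t)`: if `DG` is injective at
the lift `(ang x, t)` for an angle function `ang` smooth at `x`, then `mfderiv (descend G) p` is
injective (`descend G = G ∘ (ang × id)` and `(circlePt × id) ∘ (ang × id) = id`). [folklore] -/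
theorem mfderiv_descend_injective_of_angle (hG : ContDiff ℝ ∞ G)
    (hper : ∀ θ t, G (θ + 1, t) = G (θ, t)) {p : (𝕊 1) × ℝ} {ang : (𝕊 1) → ℝ}
    (hang : ContMDiffAt (𝓡 1) 𝓘(ℝ, ℝ) ∞ ang p.1) (hsec : ∀ u, circlePt (ang u) = u)
    (hinj : Injective (fderiv ℝ G (ang p.1, p.2))) :
    Injective (mfderiv 𝓘₁₁ 𝓘(ℝ, 𝔼 4) (descend G) p) := by
  have hn : (∞ : WithTop ℕ∞) ≠ 0 := by simp
  set A : (𝕊 1) × ℝ → ℝ × ℝ := fun q ↦ (ang q.1, q.2) with hAdef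
  set P : ℝ × ℝ → (𝕊 1) × ℝ := fun q ↦ (circlePt q.1, q.2) with hPdef
  have hA : ContMDiffAt 𝓘₁₁ 𝓘(ℝ, ℝ × ℝ) ∞ A p := contMDiffAt_angleProd hang
  have hP : ContMDiff 𝓘(ℝ, ℝ × ℝ) 𝓘₁₁ ∞ P :=
    (contMDiff_circlePt.comp contDiff_fst.contMDiff).prodMk contDiff_snd.contMDiff
  have hPA : P ∘ A = id := funext fun q ↦ Prod.ext (hsec q.1) rfl
  have hAd := hA.mdifferentiableAt hn
  have hPd := (hP (A p)).mdifferentiableAt hn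
  have hc : HasMFDerivAt 𝓘₁₁ 𝓘₁₁ (P ∘ A) p
      ((mfderiv 𝓘(ℝ, ℝ × ℝ) 𝓘₁₁ P (A p)).comp (mfderiv 𝓘₁₁ 𝓘(ℝ, ℝ × ℝ) A p)) :=
    hPd.hasMFDerivAt.comp p hAd.hasMFDerivAt
  have hid : HasMFDerivAt 𝓘₁₁ 𝓘₁₁ (P ∘ A) p (ContinuousLinearMap.id ℝ (TangentSpace 𝓘₁₁ p)) := by
    rw [hPA]; exact hasMFDerivAt_id p
  have key1 := hasMFDerivAt_unique hc hid
  have hAinj : Injective (mfderiv 𝓘₁₁ 𝓘(ℝ, ℝ × ℝ) A p) := by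
    refine LeftInverse.injective (g := mfderiv 𝓘(ℝ, ℝ × ℝ) 𝓘₁₁ P (A p)) fun v ↦ ?_
    exact DFunLike.congr_fun key1 v
  have hfun : G ∘ A = descend G := by
    funext q
    show G (ang q.1, q.2) = G (angA q.1, q.2)
    exact apply_eq_of_circlePt_eq hper (by rw [hsec, circlePt_angA]) q.2
  have hGd : MDifferentiableAt 𝓘(ℝ, ℝ × ℝ) 𝓘(ℝ, 𝔼 4) G (A p) :=
    ((hG.differentiable (by simp)) (A p)).mdifferentiableAt
  have hc2 : HasMFDerivAt 𝓘₁₁ 𝓘(ℝ, 𝔼 4) (descend G) p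
      ((mfderiv 𝓘(ℝ, ℝ × ℝ) 𝓘(ℝ, 𝔼 4) G (A p)).comp (mfderiv 𝓘₁₁ 𝓘(ℝ, ℝ × ℝ) A p)) := by
    rw [← hfun]
    exact hGd.hasMFDerivAt.comp p hAd.hasMFDerivAt
  rw [hc2.mfderiv]
  have hGinj : Injective (mfderiv 𝓘(ℝ, ℝ × ℝ) 𝓘(ℝ, 𝔼 4) G (A p)) := by
    rw [mfderiv_eq_fderiv]; exact hinj
  exact hGinj.comp hAinj

/-- **Injectivity of the differential of the descent** from injectivity of `fderiv G` at every
lift of the point. [folklore] -/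
theorem mfderiv_descend_injective (hG : ContDiff ℝ ∞ G)
    (hper : ∀ θ t, G (θ + 1, t) = G (θ, t)) {p : (𝕊 1) × ℝ}
    (hinj : ∀ u : ℝ, circlePt u = p.1 → Injective (fderiv ℝ G (u, p.2))) :
    Injective (mfderiv 𝓘₁₁ 𝓘(ℝ, 𝔼 4) (descend G) p) := by
  by_cases hp : p.1 = ptA
  · have hB : p.1 ≠ ptB := by rw [hp]; exact ptA_ne_ptB
    exact mfderiv_descend_injective_of_angle hG hper (contMDiffAt_angB hB) circlePt_angB
      (hinj _ (circlePt_angB _))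
  · exact mfderiv_descend_injective_of_angle hG hper (contMDiffAt_angA hp) circlePt_angA
      (hinj _ (circlePt_angA _))

end Descend

/-! ### Arcs of the circle, read on the parameter line -/

/-- `u : ℝ` lies **in the arc `[a, b]` modulo the period**: the point `circlePt u` lies in the
image of `[a, b]`. [folklore] -/
def InArc (a b u : ℝ) : Prop :=
  circlePt u ∈ circlePt '' Icc a b

/-- `u` is in the arc `[a, b]` iff some integer translate of `u` lies in `[a, b]`. [folklore] -/
theorem inArc_iff {a b u : ℝ} : InArc a b u ↔ ∃ m : ℤ, u - m ∈ Icc a b := by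
  constructor
  · rintro ⟨s, hs, he⟩
    obtain ⟨m, hm⟩ := circlePt_eq_circlePt_iff.1 he.symm
    exact ⟨m, by rw [hm, add_sub_cancel_right]; exact hs⟩
  · rintro ⟨m, hm⟩
    refine ⟨u - m, hm, ?_⟩
    rw [circlePt_eq_circlePt_iff]
    exact ⟨-m, by push_cast; ring⟩

/-- Points of `[a, b]` are in the arc. [folklore] -/
theorem inArc_of_mem {a b u : ℝ} (h : u ∈ Icc a b) : InArc a b u :=
  ⟨u, h, rfl⟩

/-- Being in the arc is invariant under integer translation. [folklore] -/
theorem inArc_add_int_iff {a b u : ℝ} (m : ℤ) : InArc a b (u + m) ↔ InArc a b u := by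
  unfold InArc
  rw [circlePt_add_int]

/-- The parameters in an arc form a closed set (preimage of a compact arc of `𝕊¹`). [folklore] -/
theorem isClosed_setOf_inArc (a b : ℝ) : IsClosed {u : ℝ | InArc a b u} :=
  ((isCompact_Icc.image continuous_circlePt).isClosed).preimage continuous_circlePt

/-! ### Periodicity of the tube in the angle -/

namespace TubeSetup

variable (S : TubeSetup)

/-- If `F` is `1`-periodic in `θ` then so is its derivative. [folklore] -/
theorem fderiv_F_add_one (hF : ∀ θ t, S.F (θ + 1, t) = S.F (θ, t)) (q : ℝ × ℝ) :
    fderiv ℝ S.F (q + (1, 0)) = fderiv ℝ S.F q := by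
  have hfun : (fun x ↦ S.F (x + (1, 0))) = S.F := by
    funext x
    obtain ⟨θ, t⟩ := x
    show S.F (θ + 1, t + 0) = S.F (θ, t)
    rw [add_zero, hF]
  rw [← fderiv_comp_add_right, hfun]

/-- The normal frame of a `1`-periodic annulus is `1`-periodic. [folklore] -/
theorem n₁_n₂_add_one (hF : ∀ θ t, S.F (θ + 1, t) = S.F (θ, t)) (θ t : ℝ) :
    S.n₁ (θ + 1, t) = S.n₁ (θ, t) ∧ S.n₂ (θ + 1, t) = S.n₂ (θ, t) := by
  have hd : fderiv ℝ S.F (θ + 1, t) = fderiv ℝ S.F (θ, t) := by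
    have := S.fderiv_F_add_one hF (θ, t)
    rwa [Prod.mk_add_mk, add_zero] at this
  have h1 : dθ S.F (θ + 1, t) = dθ S.F (θ, t) := by
    show fderiv ℝ S.F (θ + 1, t) (1, 0) = fderiv ℝ S.F (θ, t) (1, 0)
    rw [hd]
  have h2 : dt S.F (θ + 1, t) = dt S.F (θ, t) := by
    show fderiv ℝ S.F (θ + 1, t) (0, 1) = fderiv ℝ S.F (θ, t) (0, 1)
    rw [hd]
  have e1 : S.n₁ (θ + 1, t) = S.n₁ (θ, t) := by
    show frame₁ S.F S.w (θ + 1, t) = frame₁ S.F S.w (θ, t)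
    unfold frame₁
    rw [h1, h2]
  refine ⟨e1, ?_⟩
  show frame₂ S.F S.w (θ + 1, t) = frame₂ S.F S.w (θ, t)
  unfold frame₂
  rw [h1, h2, show frame₁ S.F S.w (θ + 1, t) = S.n₁ (θ + 1, t) from rfl, e1]

/-- The cone frame of a `1`-periodic curve is `1`-periodic. [folklore] -/
theorem M₁_M₂_add_one {k : ℝ → 𝔼 4} (hk : Periodic k 1) (θ : ℝ) :
    S.M₁ k (θ + 1) = S.M₁ k θ ∧ S.M₂ k (θ + 1) = S.M₂ k θ := by
  have hk' : deriv k (θ + 1) = deriv k θ := (Function.Periodic.deriv hk) θ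
  have e1 : S.M₁ k (θ + 1) = S.M₁ k θ := by
    unfold M₁
    rw [hk', hk]
  refine ⟨e1, ?_⟩
  unfold M₂
  rw [hk', hk, e1]

/-- **The tube of a periodic setup is `1`-periodic in the angle.** [folklore] -/
theorem tube_add_one (hF : ∀ θ t, S.F (θ + 1, t) = S.F (θ, t)) (hk₁ : Periodic S.k₁ 1)
    (hk₂ : Periodic S.k₂ 1) (θ t : ℝ) (d : ℝ × ℝ) :
    S.tube ((θ + 1, t), d) = S.tube ((θ, t), d) := by
  obtain ⟨e1, e2⟩ := S.n₁_n₂_add_one hF θ t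
  obtain ⟨a1, a2⟩ := S.M₁_M₂_add_one hk₁ θ
  obtain ⟨b1, b2⟩ := S.M₁_M₂_add_one hk₂ θ
  unfold tube coneTube coneAff affTube
  simp only [hF, e1, e2, hk₁ θ, hk₂ θ, a1, a2, b1, b2]

/-- The tube of a periodic setup is periodic under all integer translations. [folklore] -/
theorem tube_add_int (hF : ∀ θ t, S.F (θ + 1, t) = S.F (θ, t)) (hk₁ : Periodic S.k₁ 1)
    (hk₂ : Periodic S.k₂ 1) (θ t : ℝ) (m : ℤ) (d : ℝ × ℝ) :
    S.tube ((θ + m, t), d) = S.tube ((θ, t), d) := by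
  have hp : Periodic (fun θ ↦ S.tube ((θ, t), d)) 1 := fun θ ↦ S.tube_add_one hF hk₁ hk₂ θ t d
  have := (hp.int_mul m) θ
  simpa using this

end TubeSetup

/-! ### Detours in tube coordinates -/

/-- A **detour** of the core curve of a good tube of angular half-width `η` and radius `ε` along
the arc `θ = θ₀`: a `C^∞` curve `u ↦ (κθ u, κd u)` in tube coordinates (base angle, normal
coordinates), equivariant under the period (`κθ (u + 1) = κθ u + 1`, `κd` periodic), equal to the
zero section `u ↦ (u, 0)` off the arc `[θ₀ - η/8, θ₀ + η/8]` (mod `1`), staying over the core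
strip `[θ₀ - η/4, θ₀ + η/4]` and inside the radius `ε` on the arc, injective modulo the period
and regular. Replacing the core strip of the annulus by `(u, t) ↦ tube ((κθ u, t), κd u)`
produces a new concordance (`Knot.IsConicalConcordance.isConcordance_descend_newLift`). [folklore] -/
structure Detour (θ₀ η ε : ℝ) where
  /-- The base angle of the detour. -/
  κθ : ℝ → ℝ
  /-- The normal coordinates of the detour. -/
  κd : ℝ → ℝ × ℝ
  contDiff_θ : ContDiff ℝ ∞ κθ
  contDiff_d : ContDiff ℝ ∞ κd
  add_one_θ : ∀ u, κθ (u + 1) = κθ u + 1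
  periodic_d : Periodic κd 1
  id_of_not_inArc : ∀ u, ¬ InArc (θ₀ - η / 8) (θ₀ + η / 8) u → κθ u = u ∧ κd u = 0
  mem_of_mem : ∀ u ∈ Icc (θ₀ - η / 8) (θ₀ + η / 8), κθ u ∈ Icc (θ₀ - η / 4) (θ₀ + η / 4)
  mem_ball : ∀ u, κd u ∈ ball (0 : ℝ × ℝ) ε
  inj : ∀ u u', κθ u = κθ u' → κd u = κd u' → ∃ m : ℤ, u' = u + m
  regular : ∀ u, deriv κθ u ≠ 0 ∨ deriv κd u ≠ 0

namespace Detour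

variable {θ₀ η ε : ℝ} (D : Detour θ₀ η ε)

/-- Integer translates of the base angle. [folklore] -/
theorem κθ_add_int (u : ℝ) (m : ℤ) : D.κθ (u + m) = D.κθ u + m := by
  have hp : ∀ n : ℕ, ∀ u, D.κθ (u + n) = D.κθ u + n := by
    intro n
    induction n with
    | zero => intro u; simp
    | succ n ih =>
      intro u
      push_cast
      rw [← add_assoc, D.add_one_θ, ih]
      ring
  rcases Int.eq_nat_or_neg m with ⟨n, rfl | rfl⟩
  · exact_mod_cast hp n u
  · have := hp n (u + (-(n : ℤ) : ℤ))
    push_cast at this ⊢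
    rw [show u + -(n : ℝ) + n = u by ring] at this
    linarith

/-- Integer translates of the normal coordinates. [folklore] -/
theorem κd_add_int (u : ℝ) (m : ℤ) : D.κd (u + m) = D.κd u := by
  have := (D.periodic_d.int_mul m) u
  simpa using this

/-- The velocity of the detour `u ↦ ((κθ u, t), κd u)` (for fixed `t`) together with the time
direction: the linear map `(a, b) ↦ ((a κθ' u, b), a • κd' u)`, injective by regularity. [folklore] -/
def velL (u : ℝ) : ℝ × ℝ →L[ℝ] (ℝ × ℝ) × (ℝ × ℝ) :=
  ((ContinuousLinearMap.fst ℝ ℝ ℝ).smulRight (deriv D.κθ u)).prod (ContinuousLinearMap.snd ℝ ℝ ℝ)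
    |>.prod ((ContinuousLinearMap.fst ℝ ℝ ℝ).smulRight (deriv D.κd u))

/-- Evaluation of `velL`. [folklore] -/
@[simp]
theorem velL_apply (u : ℝ) (v : ℝ × ℝ) :
    D.velL u v = ((v.1 * deriv D.κθ u, v.2), v.1 • deriv D.κd u) := by
  simp [velL]

/-- `velL` is injective (the detour is regular). [folklore] -/
theorem injective_velL (u : ℝ) : Injective (D.velL u) := by
  refine (injective_iff_map_eq_zero _).2 fun v hv ↦ ?_
  rw [velL_apply, Prod.mk_eq_zero, Prod.mk_eq_zero] at hv
  obtain ⟨⟨h1, h2⟩, h3⟩ := hv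
  have ha : v.1 = 0 := by
    rcases D.regular u with h | h
    · exact (mul_eq_zero.1 h1).resolve_right h
    · exact (smul_eq_zero.1 h3).resolve_right h
  exact Prod.ext ha h2

/-- The map `(u, t) ↦ ((κθ u, t), κd u)` has derivative `velL u` at `(u, t)`. [folklore] -/
theorem hasFDerivAt_coords (q : ℝ × ℝ) :
    HasFDerivAt (fun q : ℝ × ℝ ↦ (((D.κθ q.1, q.2) : ℝ × ℝ), D.κd q.1)) (D.velL q.1) q := by
  have hθ : HasFDerivAt (fun q : ℝ × ℝ ↦ D.κθ q.1)
      (((1 : ℝ →L[ℝ] ℝ).smulRight (deriv D.κθ q.1)).comp (ContinuousLinearMap.fst ℝ ℝ ℝ)) q :=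
    ((D.contDiff_θ.differentiable (by simp)) q.1).hasDerivAt.hasFDerivAt.comp q hasFDerivAt_fst
  have hd : HasFDerivAt (fun q : ℝ × ℝ ↦ D.κd q.1)
      (((1 : ℝ →L[ℝ] ℝ).smulRight (deriv D.κd q.1)).comp (ContinuousLinearMap.fst ℝ ℝ ℝ)) q :=
    ((D.contDiff_d.differentiable (by simp)) q.1).hasDerivAt.hasFDerivAt.comp q hasFDerivAt_fst
  have h := (hθ.prodMk hasFDerivAt_snd).prodMk hd
  refine h.congr_fderiv ?_
  ext <;> simp [velL, mul_comm]

end Detour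

end StripFrame

namespace Knot.IsConicalConcordance

open StripFrame

variable {K K' : Knot} {f : (𝕊 1) × ℝ → 𝔼 4} {δ : ℝ}

/-- The tube of the setup of a conical concordance is `1`-periodic in the angle. [folklore] -/
theorem tube_add_int (h : IsConicalConcordance K K' f δ) (w : 𝔼 4) (θ t : ℝ) (m : ℤ)
    (d : ℝ × ℝ) : (h.setup w).tube ((θ + m, t), d) = (h.setup w).tube ((θ, t), d) :=
  (h.setup w).tube_add_int (fun θ t ↦ by
      have := annulusLift_add_int f θ t 1
      simpa using this)
    K.periodic_curve K'.periodic_curve θ t m d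

variable (h : IsConicalConcordance K K' f δ) (w : 𝔼 4) {θ₀ η ε : ℝ} (D : Detour θ₀ η ε)

/-! ### The new lift -/

/-- **The new lift**: the annulus with its core strip replaced by the detour, read through the
tube, `(u, t) ↦ tube ((κθ u, t), κd u)`. Off the arc it is the old lift `annulusLift f`.
[folklore] -/
def newLift (q : ℝ × ℝ) : 𝔼 4 :=
  (h.setup w).tube ((D.κθ q.1, q.2), D.κd q.1)

/-- Pointwise formula. [folklore] -/
theorem newLift_apply (u t : ℝ) :
    h.newLift w D (u, t) = (h.setup w).tube ((D.κθ u, t), D.κd u) := rfl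

/-- The new lift is `C^∞`. [folklore] -/
theorem contDiff_newLift : ContDiff ℝ ∞ (h.newLift w D) :=
  (h.setup w).contDiff_tube.comp
    (((D.contDiff_θ.comp contDiff_fst).prodMk contDiff_snd).prodMk (D.contDiff_d.comp contDiff_fst))

/-- The new lift is `1`-periodic in `u`. [folklore] -/
theorem newLift_add_int (u t : ℝ) (m : ℤ) : h.newLift w D (u + m, t) = h.newLift w D (u, t) := by
  rw [newLift_apply, newLift_apply, D.κθ_add_int, D.κd_add_int, h.tube_add_int]

/-- The new lift is `1`-periodic (the form used by the descent lemmas). [folklore] -/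
theorem newLift_add_one (u t : ℝ) : h.newLift w D (u + 1, t) = h.newLift w D (u, t) := by
  have := h.newLift_add_int w D u t 1
  simpa using this

/-- **Off the arc the new lift is the old one.** [folklore] -/
theorem newLift_of_not_inArc {u : ℝ} (hu : ¬ InArc (θ₀ - η / 8) (θ₀ + η / 8) u) (t : ℝ) :
    h.newLift w D (u, t) = annulusLift f (u, t) := by
  obtain ⟨h1, h2⟩ := D.id_of_not_inArc u hu
  rw [newLift_apply, h1, h2]
  exact (h.setup w).tube_zero (u, t)

/-- Near the inner end the new lift lies on the sphere of radius `|t|`. [folklore] -/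
theorem norm_newLift_of_le {t : ℝ} (ht : t ≤ 1 + δ / 4) (u : ℝ) : ‖h.newLift w D (u, t)‖ = |t| :=
  (h.setup w).norm_tube_of_le (show t ≤ 1 + (h.setup w).δ / 4 from ht) _

/-- Near the outer end the new lift lies on the sphere of radius `|t|`. [folklore] -/
theorem norm_newLift_of_ge {t : ℝ} (ht : 2 - δ / 4 ≤ t) (u : ℝ) : ‖h.newLift w D (u, t)‖ = |t| :=
  (h.setup w).norm_tube_of_ge (show 2 - (h.setup w).δ / 4 ≤ t from ht) _

/-- **Near the inner end the new lift is the cone over its inner end curve**: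
`newLift (u, t) = t • newLift (u, 1)` for `t ≤ 1 + δ/4` (the cone tube does not depend on `t`
except through the factor `t`). [folklore] -/
theorem newLift_of_le {t : ℝ} (ht : t ≤ 1 + δ / 4) (u : ℝ) :
    h.newLift w D (u, t) = t • h.newLift w D (u, 1) := by
  rw [newLift_apply, newLift_apply,
    (h.setup w).tube_of_le (show t ≤ 1 + (h.setup w).δ / 4 from ht),
    (h.setup w).tube_of_le (show (1 : ℝ) ≤ 1 + (h.setup w).δ / 4 by
      have := h.δ_pos; simp only [setup_δ]; linarith)]
  simp [TubeSetup.coneTube, TubeSetup.coneAff]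

/-- **Near the outer end the new lift is the cone over its outer end curve**:
`newLift (u, t) = (t / 2) • newLift (u, 2)` for `t ≥ 2 - δ/4`. [folklore] -/
theorem newLift_of_ge {t : ℝ} (ht : 2 - δ / 4 ≤ t) (u : ℝ) :
    h.newLift w D (u, t) = (t / 2) • h.newLift w D (u, 2) := by
  rw [newLift_apply, newLift_apply,
    (h.setup w).tube_of_ge (show 2 - (h.setup w).δ / 4 ≤ t from ht),
    (h.setup w).tube_of_ge (show 2 - (h.setup w).δ / 4 ≤ (2 : ℝ) by
      have := h.δ_pos; simp only [setup_δ]; linarith)]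
  simp only [TubeSetup.coneTube, TubeSetup.coneAff, smul_smul]
  congr 1
  ring

/-! ### The derivative of the new lift -/

/-- The new lift has derivative `D(tube) ∘ velL`. [folklore] -/
theorem hasFDerivAt_newLift (q : ℝ × ℝ) :
    HasFDerivAt (h.newLift w D)
      ((fderiv ℝ (h.setup w).tube ((D.κθ q.1, q.2), D.κd q.1)).comp (D.velL q.1)) q :=
  (((h.setup w).contDiff_tube.differentiable (by simp)) _).hasFDerivAt.comp q
    (D.hasFDerivAt_coords q)

variable {w D}

/-- **The new lift is an immersion over the annulus `1 ≤ t ≤ 2`**, given a good tube: off the arc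
it is the old lift (an immersion), on the arc the tube has injective derivative and the detour
is regular. [folklore] -/
theorem injective_fderiv_newLift (G : (h.setup w).GoodTube θ₀ η ε) (u : ℝ) {t : ℝ}
    (ht : t ∈ Icc (1 : ℝ) 2) : Injective (fderiv ℝ (h.newLift w D) (u, t)) := by
  have hδ := h.δ_pos
  by_cases hu : InArc (θ₀ - η / 8) (θ₀ + η / 8) u
  · -- on the arc: reduce to the period window
    obtain ⟨m, hm⟩ := inArc_iff.1 hu
    have hper : h.newLift w D = fun q ↦ h.newLift w D (q + (-(m : ℝ), 0)) := by
      funext q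
      obtain ⟨v, s⟩ := q
      show h.newLift w D (v, s) = h.newLift w D (v + -(m : ℝ), s + 0)
      rw [add_zero, show v + -(m : ℝ) = v + ((-m : ℤ) : ℝ) by push_cast; ring, h.newLift_add_int]
    rw [hper, fderiv_comp_add_right]
    simp only [Prod.mk_add_mk, add_zero]
    rw [(h.hasFDerivAt_newLift w D (u + -(m : ℝ), t)).fderiv, ContinuousLinearMap.coe_comp]
    refine Injective.comp ?_ (D.injective_velL _)
    have hθ := D.mem_of_mem (u - m) hm
    have e : u + -(m : ℝ) = u - m := by ring
    simp only [e]
    exact G.injective_fderiv ((D.κθ (u - m), t), D.κd (u - m))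
      (mk_mem_prod (mk_mem_prod ⟨by linarith [hθ.1, G.η_pos], by linarith [hθ.2, G.η_pos]⟩ ht)
        (D.mem_ball _))
  · -- off the arc: locally the old lift
    have hev : h.newLift w D =ᶠ[𝓝 (u, t)] annulusLift f := by
      have hO : IsOpen {q : ℝ × ℝ | ¬ InArc (θ₀ - η / 8) (θ₀ + η / 8) q.1} :=
        (isClosed_setOf_inArc _ _).isOpen_compl.preimage continuous_fst
      filter_upwards [hO.mem_nhds hu] with q hq
      obtain ⟨v, s⟩ := q
      exact h.newLift_of_not_inArc w D hq s
    rw [hev.fderiv_eq]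
    exact h.injective_fderiv_annulusLift u ⟨by linarith [ht.1], by linarith [ht.2]⟩

/-- **The new lift identifies exactly the period translates over the annulus `1 ≤ t ≤ 2`**, given
a good tube (separation of the tube from the far sheet of the annulus, injectivity of the tube,
injectivity of the old lift and of the detour modulo the period). [folklore] -/
theorem eq_of_newLift_eq (G : (h.setup w).GoodTube θ₀ η ε) {u t u' t' : ℝ}
    (ht : t ∈ Icc (1 : ℝ) 2) (ht' : t' ∈ Icc (1 : ℝ) 2)
    (he : h.newLift w D (u, t) = h.newLift w D (u', t')) : t = t' ∧ ∃ m : ℤ, u' = u + m := by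
  -- a point of the arc, read in the window, gives tube data over the core strip
  have key : ∀ {u : ℝ} {m : ℤ}, u - m ∈ Icc (θ₀ - η / 8) (θ₀ + η / 8) → ∀ t : ℝ,
      h.newLift w D (u, t) = (h.setup w).tube ((D.κθ (u - m), t), D.κd (u - m)) ∧
      (D.κθ (u - m), t) ∈ Icc (θ₀ - η / 4) (θ₀ + η / 4) ×ˢ ({t} : Set ℝ) := by
    intro u m hm t
    refine ⟨?_, mk_mem_prod (D.mem_of_mem _ hm) rfl⟩
    rw [show u = (u - m) + (m : ℝ) by ring, h.newLift_add_int, newLift_apply]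
    simp
  have hcoreT : ∀ {θ : ℝ}, θ ∈ Icc (θ₀ - η / 4) (θ₀ + η / 4) → θ ∈ Icc (θ₀ - η) (θ₀ + η) :=
    fun hθ ↦ ⟨by linarith [hθ.1, G.η_pos], by linarith [hθ.2, G.η_pos]⟩
  by_cases hu : InArc (θ₀ - η / 8) (θ₀ + η / 8) u <;>
    by_cases hu' : InArc (θ₀ - η / 8) (θ₀ + η / 8) u'
  · -- both on the arc: injectivity of the tube and of the detour
    obtain ⟨m, hm⟩ := inArc_iff.1 hu
    obtain ⟨m', hm'⟩ := inArc_iff.1 hu'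
    obtain ⟨e1, hq1⟩ := key hm t
    obtain ⟨e2, hq2⟩ := key hm' t'
    rw [e1, e2] at he
    have := G.injOn ⟨mk_mem_prod (hcoreT hq1.1) ht, D.mem_ball _⟩
      ⟨mk_mem_prod (hcoreT hq2.1) ht', D.mem_ball _⟩ he
    simp only [Prod.mk.injEq] at this
    obtain ⟨⟨hθe, hte⟩, hde⟩ := this
    obtain ⟨n, hn⟩ := D.inj _ _ hθe hde
    exact ⟨hte, n + m' - m, by push_cast; linarith⟩
  · -- `u` on the arc, `u'` off: separation
    obtain ⟨m, hm⟩ := inArc_iff.1 hu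
    obtain ⟨e1, hq1⟩ := key hm t
    rw [e1, h.newLift_of_not_inArc w D hu' t'] at he
    obtain ⟨hd0, htt, n, hn⟩ := G.separated _ (mk_mem_prod hq1.1 ht) _ (D.mem_ball _) u' t' ht' he
    simp only at htt hn
    refine ⟨htt.symm, ?_⟩
    -- `u'` off the arc is the zero section; compare with the detour at `u - m + n`
    obtain ⟨hθ', hd'⟩ := D.id_of_not_inArc u' hu'
    have hθe : D.κθ (u - m + n) = D.κθ u' := by
      rw [show u - m + (n : ℝ) = (u - m) + (n : ℝ) from rfl, D.κθ_add_int, hθ', hn]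
    have hde : D.κd (u - m + n) = D.κd u' := by
      rw [D.κd_add_int, hd0, hd']
    obtain ⟨n', hn'⟩ := D.inj _ _ hθe hde
    exact ⟨n + n' - m, by rw [hn']; push_cast; ring⟩
  · -- `u` off the arc, `u'` on: separation, symmetric
    obtain ⟨m, hm⟩ := inArc_iff.1 hu'
    obtain ⟨e1, hq1⟩ := key hm t'
    rw [e1, h.newLift_of_not_inArc w D hu t] at he
    obtain ⟨hd0, htt, n, hn⟩ :=
      G.separated _ (mk_mem_prod hq1.1 ht') _ (D.mem_ball _) u t ht he.symm
    simp only at htt hn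
    refine ⟨htt, ?_⟩
    obtain ⟨hθ', hd'⟩ := D.id_of_not_inArc u hu
    have hθe : D.κθ (u' - m + n) = D.κθ u := by
      rw [D.κθ_add_int, hθ', hn]
    have hde : D.κd (u' - m + n) = D.κd u := by
      rw [D.κd_add_int, hd0, hd']
    obtain ⟨n', hn'⟩ := D.inj _ _ hθe hde
    exact ⟨m - n - n', by push_cast; linarith⟩
  · -- both off the arc: the old lift
    rw [h.newLift_of_not_inArc w D hu t, h.newLift_of_not_inArc w D hu' t'] at he
    exact h.exists_int_of_F_eq ht ht' he

/-- **Over the open annulus the new lift stays in the open shell.** [folklore] -/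
theorem norm_newLift_mem (G : (h.setup w).GoodTube θ₀ η ε) (u : ℝ) {t : ℝ} (ht : t ∈ Ioo (1 : ℝ) 2) :
    1 < ‖h.newLift w D (u, t)‖ ∧ ‖h.newLift w D (u, t)‖ < 2 := by
  by_cases hu : InArc (θ₀ - η / 8) (θ₀ + η / 8) u
  · obtain ⟨m, hm⟩ := inArc_iff.1 hu
    rw [show u = (u - m) + (m : ℝ) by ring, h.newLift_add_int, newLift_apply]
    have hθ := D.mem_of_mem _ hm
    exact G.norm_mem _ (mk_mem_prod ⟨by linarith [hθ.1, G.η_pos], by linarith [hθ.2, G.η_pos]⟩ ht)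
      _ (D.mem_ball _)
  · rw [h.newLift_of_not_inArc w D hu t, annulusLift_apply]
    exact h.isConcordance.2.2.2.1 (circlePt u) t ht

/-! ### The end curves of the new lift -/

variable (w D)

/-- The **inner end curve** of the new lift, in the `2π`-periodic parametrisation of
`KnotOfClosedCurve.lean`: `θ ↦ newLift (θ / 2π, 1)`. [folklore] -/
def endCurve₁ (θ : ℝ) : 𝔼 4 :=
  h.newLift w D (θ / (2 * Real.pi), 1)

/-- The **outer end curve** of the new lift, rescaled to the unit sphere:
`θ ↦ ½ • newLift (θ / 2π, 2)`. [folklore] -/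
def endCurve₂ (θ : ℝ) : 𝔼 4 :=
  (1 / 2 : ℝ) • h.newLift w D (θ / (2 * Real.pi), 2)

/-- `circlePoint θ = circlePt (θ / 2π)`. [folklore] -/
theorem _root_.Literature.Topology.FourManifolds.circlePoint_eq_circlePt_div (θ : ℝ) :
    circlePoint θ = circlePt (θ / (2 * Real.pi)) := by
  rw [circlePt_eq_circlePoint, mul_div_cancel₀ _ (by positivity)]

/-- The parameter change `θ ↦ (θ / 2π, c)` has derivative `(1 / 2π, 0)`. [folklore] -/
theorem hasDerivAt_param (c θ : ℝ) :
    HasDerivAt (fun θ : ℝ ↦ ((θ / (2 * Real.pi), c) : ℝ × ℝ)) ((1 / (2 * Real.pi), 0) : ℝ × ℝ) θ := by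
  have h1 : HasDerivAt (fun θ : ℝ ↦ θ / (2 * Real.pi)) (1 / (2 * Real.pi)) θ := by
    simpa using (hasDerivAt_id θ).div_const (2 * Real.pi)
  exact h1.prodMk (hasDerivAt_const θ c)

/-- The velocity of the inner end curve. [folklore] -/
theorem hasDerivAt_endCurve₁ (θ : ℝ) :
    HasDerivAt (h.endCurve₁ w D)
      (fderiv ℝ (h.newLift w D) (θ / (2 * Real.pi), 1) ((1 / (2 * Real.pi), 0) : ℝ × ℝ)) θ :=
  (((h.contDiff_newLift w D).differentiable (by simp)) _).hasFDerivAt.comp_hasDerivAt θ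
    (hasDerivAt_param 1 θ)

/-- The velocity of the outer end curve. [folklore] -/
theorem hasDerivAt_endCurve₂ (θ : ℝ) :
    HasDerivAt (h.endCurve₂ w D)
      ((1 / 2 : ℝ) • fderiv ℝ (h.newLift w D) (θ / (2 * Real.pi), 2)
        ((1 / (2 * Real.pi), 0) : ℝ × ℝ)) θ :=
  ((((h.contDiff_newLift w D).differentiable (by simp)) _).hasFDerivAt.comp_hasDerivAt θ
    (hasDerivAt_param 2 θ)).const_smul (1 / 2 : ℝ)

variable {w}

/-- **The inner end curve is a regular closed curve on `𝕊³`** (given a good tube). [folklore] -/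
theorem isRegularClosedCurve_endCurve₁ (G : (h.setup w).GoodTube θ₀ η ε) :
    IsRegularClosedCurve (h.endCurve₁ w D) where
  contDiff := (h.contDiff_newLift w D).comp
    ((contDiff_id.div_const _).prodMk contDiff_const)
  periodic θ := by
    simp only [endCurve₁]
    rw [add_div, div_self (by positivity)]
    exact h.newLift_add_one w D _ 1
  norm_eq_one θ := by
    simp only [endCurve₁]
    rw [h.norm_newLift_of_le w D (by linarith [h.δ_pos]), abs_one]
  deriv_ne_zero θ := by
    rw [(h.hasDerivAt_endCurve₁ w D θ).deriv]
    intro h0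
    have := (injective_iff_map_eq_zero _).1 (h.injective_fderiv_newLift G _ ⟨le_rfl, by norm_num⟩)
      _ h0
    simp [Real.pi_ne_zero] at this

/-- **The outer end curve is a regular closed curve on `𝕊³`** (given a good tube). [folklore] -/
theorem isRegularClosedCurve_endCurve₂ (G : (h.setup w).GoodTube θ₀ η ε) :
    IsRegularClosedCurve (h.endCurve₂ w D) where
  contDiff := by
    have h1 : ContDiff ℝ ∞ fun θ : ℝ ↦ h.newLift w D (θ / (2 * Real.pi), 2) :=
      (h.contDiff_newLift w D).comp ((contDiff_id.div_const _).prodMk contDiff_const)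
    exact (contDiff_const (c := (1 / 2 : ℝ))).smul h1
  periodic θ := by
    simp only [endCurve₂]
    rw [add_div, div_self (by positivity), h.newLift_add_one]
  norm_eq_one θ := by
    simp only [endCurve₂]
    rw [norm_smul, h.norm_newLift_of_ge w D (by linarith [h.δ_pos])]
    norm_num
  deriv_ne_zero θ := by
    rw [(h.hasDerivAt_endCurve₂ w D θ).deriv]
    intro h0
    have h0' := (smul_eq_zero.1 h0).resolve_left (by norm_num)
    have := (injective_iff_map_eq_zero _).1
      (h.injective_fderiv_newLift G _ ⟨by norm_num, le_rfl⟩) _ h0'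
    simp [Real.pi_ne_zero] at this

/-- Equal values of the new lift at time `t ∈ [1, 2]` force equal points of the circle in the
`2π`-parametrisation. [folklore] -/
theorem circlePoint_eq_of_newLift_eq (G : (h.setup w).GoodTube θ₀ η ε) {t : ℝ}
    (ht : t ∈ Icc (1 : ℝ) 2) {s s' : ℝ}
    (he : h.newLift w D (s / (2 * Real.pi), t) = h.newLift w D (s' / (2 * Real.pi), t)) :
    circlePoint s = circlePoint s' := by
  obtain ⟨-, m, hm⟩ := h.eq_of_newLift_eq G ht ht he
  have hs' : s' = s + m * (2 * Real.pi) := by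
    have h2 : (0 : ℝ) < 2 * Real.pi := by positivity
    field_simp at hm
    linarith
  rw [hs']
  exact ((periodic_circlePoint.int_mul m) s).symm

/-- The inner end curve is injective modulo `2π`. [folklore] -/
theorem endCurve₁_inj (G : (h.setup w).GoodTube θ₀ η ε) (s s' : ℝ)
    (he : h.endCurve₁ w D s = h.endCurve₁ w D s') : circlePoint s = circlePoint s' :=
  h.circlePoint_eq_of_newLift_eq D G ⟨le_rfl, by norm_num⟩ he

/-- The outer end curve is injective modulo `2π`. [folklore] -/
theorem endCurve₂_inj (G : (h.setup w).GoodTube θ₀ η ε) (s s' : ℝ)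
    (he : h.endCurve₂ w D s = h.endCurve₂ w D s') : circlePoint s = circlePoint s' :=
  h.circlePoint_eq_of_newLift_eq D G ⟨by norm_num, le_rfl⟩
    (smul_right_injective (𝔼 4) (by norm_num : (1 / 2 : ℝ) ≠ 0) he)

/-- **The inner end knot** of the new lift (`IsRegularClosedCurve.toKnot`). [folklore] -/
def newKnot₁ (G : (h.setup w).GoodTube θ₀ η ε) : Knot :=
  (h.isRegularClosedCurve_endCurve₁ D G).toKnot (h.endCurve₁_inj D G)

/-- **The outer end knot** of the new lift. [folklore] -/
def newKnot₂ (G : (h.setup w).GoodTube θ₀ η ε) : Knot :=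
  (h.isRegularClosedCurve_endCurve₂ D G).toKnot (h.endCurve₂_inj D G)

/-- The inner end knot passes through `newLift (θ / 2π, 1)` at `circlePoint θ`. [folklore] -/
theorem coe_newKnot₁_circlePoint (G : (h.setup w).GoodTube θ₀ η ε) (θ : ℝ) :
    ((h.newKnot₁ D G (circlePoint θ) : 𝕊 3) : 𝔼 4) = h.newLift w D (θ / (2 * Real.pi), 1) :=
  (h.isRegularClosedCurve_endCurve₁ D G).coe_toKnot_circlePoint _ θ

/-- The outer end knot passes through `½ • newLift (θ / 2π, 2)` at `circlePoint θ`. [folklore] -/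
theorem coe_newKnot₂_circlePoint (G : (h.setup w).GoodTube θ₀ η ε) (θ : ℝ) :
    ((h.newKnot₂ D G (circlePoint θ) : 𝕊 3) : 𝔼 4) =
      (1 / 2 : ℝ) • h.newLift w D (θ / (2 * Real.pi), 2) :=
  (h.isRegularClosedCurve_endCurve₂ D G).coe_toKnot_circlePoint _ θ

/-! ### The new concordance -/

variable (w)

/-- **The new annulus** on `𝕊¹ × ℝ`: the descent of the new lift. [folklore] -/
def newAnnulus : (𝕊 1) × ℝ → 𝔼 4 :=
  descend (h.newLift w D)

/-- The new annulus in the angle coordinate `angA`. [folklore] -/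
theorem newAnnulus_apply (x : 𝕊 1) (t : ℝ) :
    h.newAnnulus w D (x, t) = h.newLift w D (angA x, t) := rfl

/-- The new annulus over `circlePoint θ`. [folklore] -/
theorem newAnnulus_circlePoint (θ t : ℝ) :
    h.newAnnulus w D (circlePoint θ, t) = h.newLift w D (θ / (2 * Real.pi), t) := by
  rw [circlePoint_eq_circlePt_div]
  exact descend_circlePt (h.newLift_add_one w D) _ _

variable {w}

/-- **Replacing a strip of a conical concordance by a detour inside a good tube yields a
concordance** between the new end knots. Fox–Milnor (1966), §1 (the carrying construction
behind "the cobordism class of `k₁ # k₂` depends only on the classes of the factors").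
[cite: FoxMilnor1966, §1] -/
theorem isConcordance_newAnnulus (G : (h.setup w).GoodTube θ₀ η ε) :
    IsConcordance (h.newKnot₁ D G) (h.newKnot₂ D G) (h.newAnnulus w D) := by
  have hδ := h.δ_pos
  have hper := h.newLift_add_one w D
  refine ⟨contMDiff_descend (h.contDiff_newLift w D) hper, ?_, ?_, ?_, ?_, ?_, ?_⟩
  · -- injectivity on the annulus
    rintro ⟨x, t⟩ ⟨-, ht⟩ ⟨x', t'⟩ ⟨-, ht'⟩ he
    rw [newAnnulus_apply, newAnnulus_apply] at he
    obtain ⟨htt, m, hm⟩ := h.eq_of_newLift_eq G ht ht' he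
    have hx : x' = x := by
      rw [← circlePt_angA x', hm, circlePt_add_int, circlePt_angA]
    rw [hx]
    exact Prod.ext rfl htt
  · -- immersion on the annulus
    rintro ⟨x, t⟩ ⟨-, ht⟩
    exact mfderiv_descend_injective (h.contDiff_newLift w D) hper
      fun u _ ↦ h.injective_fderiv_newLift G u ht
  · -- the open annulus goes into the open shell
    intro x t ht
    rw [newAnnulus_apply]
    exact h.norm_newLift_mem G _ ht
  · -- neatness: the ends are cones
    intro x
    constructor
    · have hev : (fun t ↦ ‖h.newAnnulus w D (x, t)‖ ^ 2) =ᶠ[𝓝 1] fun t ↦ t ^ 2 := by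
        filter_upwards [Ioo_mem_nhds (by norm_num : (0 : ℝ) < 1)
          (by linarith : (1 : ℝ) < 1 + δ / 4)] with t ht
        rw [newAnnulus_apply, h.norm_newLift_of_le w D ht.2.le, sq_abs]
      rw [hev.deriv_eq]
      norm_num
    · have hev : (fun t ↦ ‖h.newAnnulus w D (x, t)‖ ^ 2) =ᶠ[𝓝 2] fun t ↦ t ^ 2 := by
        filter_upwards [Ioi_mem_nhds (by linarith : (2 : ℝ) - δ / 4 < 2)] with t ht
        rw [newAnnulus_apply, h.norm_newLift_of_ge w D (le_of_lt ht), sq_abs]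
      rw [hev.deriv_eq]
      norm_num
  · -- the inner end is the inner end knot
    intro x
    obtain ⟨θ, rfl⟩ := circlePoint_surjective x
    rw [newAnnulus_circlePoint, coe_newKnot₁_circlePoint]
  · -- the outer end is twice the outer end knot
    intro x
    obtain ⟨θ, rfl⟩ := circlePoint_surjective x
    rw [newAnnulus_circlePoint, coe_newKnot₂_circlePoint, smul_smul]
    norm_num

/-- **The new concordance is again conical**, of width `δ/4`: near the ends the new lift is the
cone over its end curves (`newLift_of_le`, `newLift_of_ge`). [folklore] -/
theorem isConicalConcordance_newAnnulus (G : (h.setup w).GoodTube θ₀ η ε) :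
    IsConicalConcordance (h.newKnot₁ D G) (h.newKnot₂ D G) (h.newAnnulus w D) (δ / 4) where
  isConcordance := h.isConcordance_newAnnulus D G
  δ_pos := by linarith [h.δ_pos]
  δ_le := by linarith [h.δ_le]
  cone₁ x t ht := by
    obtain ⟨θ, rfl⟩ := circlePoint_surjective x
    rw [newAnnulus_circlePoint, coe_newKnot₁_circlePoint, h.newLift_of_le w D ht]
  cone₂ x t ht := by
    obtain ⟨θ, rfl⟩ := circlePoint_surjective x
    rw [newAnnulus_circlePoint, coe_newKnot₂_circlePoint, h.newLift_of_ge w D ht, smul_smul]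
    congr 1
    ring

/-- **Off the arc the new end knots agree with the old ones**: at `circlePt u` with `u` off the
arc, `newKnot₁ = K` and `newKnot₂ = K'` (as points of `ℝ⁴`). [folklore] -/
theorem coe_newKnot_circlePt_of_not_inArc (G : (h.setup w).GoodTube θ₀ η ε) {u : ℝ}
    (hu : ¬ InArc (θ₀ - η / 8) (θ₀ + η / 8) u) :
    ((h.newKnot₁ D G (circlePt u) : 𝕊 3) : 𝔼 4) = K (circlePt u) ∧
      ((h.newKnot₂ D G (circlePt u) : 𝕊 3) : 𝔼 4) = K' (circlePt u) := by
  have e : circlePt u = circlePoint (2 * Real.pi * u) := rfl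
  constructor
  · rw [e, coe_newKnot₁_circlePoint, mul_div_cancel_left₀ _ (by positivity),
      h.newLift_of_not_inArc w D hu, annulusLift_apply, h.cone₁ _ 1 (by linarith [h.δ_pos]),
      one_smul, ← e]
  · rw [e, coe_newKnot₂_circlePoint, mul_div_cancel_left₀ _ (by positivity),
      h.newLift_of_not_inArc w D hu, annulusLift_apply, h.cone₂ _ 2 (by linarith [h.δ_pos]),
      smul_smul, ← e]
    norm_num

end Knot.IsConicalConcordance

end Literature.Topology.FourManifolds
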